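import Summits.HodgeConjecture.HodgeConjecture.Theorems.R90S10ArchTransferSignsOfArchKit   -- ★ p863153: `ArchSignKit` + (E-R1)(E-R2) read-offs, `isArchPseudoCoeffSystem_of_pseudoCoeff`, `archSmooth_sub`
import Summits.HodgeConjecture.HodgeConjecture.Theorems.R90S2ArchCuspPinDefs               -- ★ p864254 (S2 FILE 1): `R90.S2.CuspG₀ ∕ CuspH₀`
import HarnessLib

/-!
# R90-TF · S10 (Rogawski 1990 §13.8) · THEOREMS — `R90S10ArchSignKitCuspOfArchBlockPacketCusp`: (H-E4-1) THE KIT CONSTRUCTOR READING S2's CUSPIDAL SOURCE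
# SOCKET (T2) — an `ArchSignKit` whose frozen function `f_{k₁} − f_{k₂}` carries the cuspidal pins, modulo T2's TYPE as ONE named hypothesis

Cell hodgecm-mathlib, slab R90-TF, section S10 = §13.8 «Proofs of local results» (Props. 13.8.1–13.8.3), crux item h413 = stmt-HodgeConjecture-24833 (route
`route-HodgeConjecture-HCCMUnconditional`).  Prover seat R90-C138-p05 (g0), DEAL #34 (R90-C138-plan (g3), 2026-09-05T02:02Z): «THEOREMS-LANE (H-E4-1)
`archSignKitCusp_of_archBlockPacketCusp (hT2 : ‹TYPE of R90.S2.stub_R90_S2_archBlockPacketCusp, S2 D ED. 2 cand 13ac8d02 :90–:126 VERBATIM›) : ‹T2's ∀-prefix› →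
∃ 𝔞 : ArchSignKit L (archDeltaPP L μ) mH mG ν νH, …` — head bytes = typ2 (g3) `ScratchE_ed4_heads.lean` a2c7579a4388e16b :27–:89 VERBATIM; imports ★ p863153 + ★ p864254
only (hypothesis-first over T2's TYPE, no S2 `Lines` import — law L9 «DEFS DOWN»)».  READER: FILE E ED. 4's ONE additions-only paid head (H-E4-2)
`archSignKitCusp_u := archSignKitCusp_of_archBlockPacketCusp R90.S2.stub_R90_S2_archBlockPacketCusp` (typ2), read by typ3's payer of `sock_S10_realiseH₂` (rows R8.3–R8.10
of PAYER-TABLE-realiseH2).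

PRINT → PROOF (Rogawski 1990 §13.8, proof of Prop. 13.8.3, p. 218 L11–28).  Print freezes `f_u = f_{1v} − f_{2v}` (L20) for two members `π_{1v}, π_{2v}` of the block
discrete-series packet with `⟨ρ_v, π_{1v}⟩ = 1`, `⟨ρ_v, π_{2v}⟩ = −1` (L15–18), and needs of `f = f_u ⊗ …` that it is CUSPIDAL with a cuspidal smooth `Δ″`-transfer
`f^H` (L26–28, via Prop. 13.7.1's frame: «`f` … such that `Tr π(f) = 0` unless `π` is cuspidal», p. 215) and `Tr ρ_u(f_u^H) = 2` (L24–25, Prop. 12.3.2).  S2's source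
socket (T2) `stub_R90_S2_archBlockPacketCusp` supplies, under print's normalised archimedean frame ((W) Weil form, (C) stable transport of `t`, (W_H)+(C_H), non-degeneracy
of `Δ″_∞ = archDeltaPP L μ`, (E5) smooth `Δ″_∞`-transfer exists), the packet `(ϖ_k)`, pseudo-coefficients `f_k` in print's wording, signs `s_k = ±1` not all equal, the
`H_∞`-representation `ρ_∞` with the Prop. 12.3.2 identity (★ `IsArchEndoCharId`), AND two members `k₁ k₂` with `s k₁ = 1`, `s k₂ = −1` whose difference `f_{k₁} − f_{k₂}`
is cuspidal at every archimedean place (★ `R90.S2.CuspG₀`), stably null (★ `IsArchStablyNull`), with a smooth cuspidal `Δ″_∞`-transfer `f^H_∞` (★ `ArchSmooth₂`,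
★ `IsArchDeltaTransfer`, ★ `R90.S2.CuspH₀`).  THIS FILE assembles the kit WITH T2's `k₁ k₂` AS THE KIT'S distinguished members — so `𝔞.frozenG = f k₁ − f k₂` BY
DEFINITION (★ `ArchSignKit.frozenG_def`) and the pins transfer verbatim —, derives (E-D4) from the pseudo-coefficient clauses (★ `isArchPseudoCoeffSystem_of_pseudoCoeff`),
smoothness of the frozen difference (★ `archSmooth_sub`), `k₁ ≠ k₂` from `s k₁ = 1 ≠ −1 = s k₂`, and reads `Θ_{ρ_∞}(f^H_∞) = 2` off ★ (E-R1∕E-R2)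
`ArchSignKit.hasArchOpTrace_two` at the supplied transfer `f^H_∞`.  Two lines of logic; every input is T2's.

HONESTY.  ZERO `sorry`; axioms ⊆ {propext, Classical.choice, Quot.sound}; no `def`, no `instance`, no `notation`; T2's TYPE is a BINDER (`hT2`), restated token
for token from typ2's checked scratch (which restates S2 D ED. 2 cand 13ac8d02 :90–:126) — never `sorry`, never an axiom, never a weaker restatement.  NON-VACUITY:
`hT2`'s conclusion is inhabited only by genuine packets (`δ_{kk}`-traces `1 ≠ 0` exclude `f := 0`; `s` takes both signs); the conclusion's kit has `𝔞.k₁ ≠ 𝔞.k₂` and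
`Θ_{ρ_∞}(f^H_∞) = 2 ≠ 0` excludes `f^H_∞ := 0`.  What this file does NOT claim: T2 itself (S2's open socket, R90-C11 ∕ K2E1b; Clozel–Delorme + Shelstad + the
cusp-form pins of §13.7) — (H-E4-1) pays nothing until S2 pays T2.  HONEST LABEL: HC_CM is proved only modulo the 7 printed citations (2 remaining named inputs:
hLiu418 = stmt-HodgeConjecture-24832, h413 = stmt-HodgeConjecture-24833) until rung 0 closes; count-neutral helper; REL ≠ ★ ≠ BUILT.
Namespace `Summit.HodgeConjecture.HodgeConjecture.R90.S10`.

## References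
* [Rogawski1990] J. D. Rogawski, *Automorphic Representations of Unitary Groups in Three Variables*, Ann. of Math. Stud. 123 (1990): §13.8 Prop. 13.8.3 (proof)
  p. 218 L11–28; §13.7 Prop. 13.7.1 p. 215; §12.3 Prop. 12.3.2 p. 178; §14.2 p. 233.
* [ClozelDelorme1984] L. Clozel, P. Delorme, *Le théorème de Paley–Wiener invariant pour les groupes de Lie réductifs*, Invent. Math. 77 (1984) (pseudo-coefficients).
* [Shelstad1979] D. Shelstad, *Characters and inner forms of a quasi-split group over ℝ*, Compositio Math. 39 (1979), Lemma 5.3.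
-/

set_option autoImplicit false
-- the mandated namespace repeats the single-problem summit's segment (`HodgeConjecture.HodgeConjecture`)
set_option linter.dupNamespace false

noncomputable section

open NumberField MeasureTheory CompactlySupported
open scoped Matrix MatrixGroups InnerProductSpace

namespace Summit.HodgeConjecture.HodgeConjecture.R90.S10

open Literature.NumberTheory.Automorphic
open Literature.NumberTheory.Rogawski1990
open Literature.NumberTheory.GaloisRepresentations (HeckeCharacter)
open Summit.HodgeConjecture.HodgeConjecture.Cruxes.H413.K2E1bGKCohomologyU21.U8 (HasArchOpTrace)
open Summit.HodgeConjecture.HodgeConjecture.R90.S2 (CuspG₀ CuspH₀)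

/-- (H-E4-1) **KIT CONSTRUCTOR READING T2 — `archSignKitCusp_of_archBlockPacketCusp`**: from S2's source socket (T2) (its TYPE, hypothesis-first, bytes verbatim) an
★ `ArchSignKit L (archDeltaPP L μ) mH mG ν νH` EXISTS whose distinguished members ARE T2's `k₁ k₂` — so that the kit's frozen difference `𝔞.frozenG = f k₁ − f k₂` carries
(g)'s pins: cuspidal at every archimedean place (★ `R90.S2.CuspG₀`), stably null (★ `IsArchStablyNull`), with a smooth cuspidal `Δ″_∞`-transfer `f^H_∞` (★ `R90.S2.CuspH₀`) and
`Θ_{ρ_∞}(f^H_∞) = 2` (★ (E-R1) `ArchSignKit.hasArchOpTrace_two`); `Θ_ϖ(f_∞) ∈ {0, ±1}` is ★ (E-R2) `ArchSignKit.isArchSignTest_frozenG 𝔞` by name.  PROOF: destructure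
`hT2` at the frame; `k₁ ≠ k₂` since `s k₁ = 1 ≠ −1 = s k₂`; the kit is the record with (E-D4) := ★ `isArchPseudoCoeffSystem_of_pseudoCoeff`, `hsmFrozen` := ★ `archSmooth_sub`,
`k₁ k₂ :=` T2's; its `frozenG` is `f k₁ − f k₂` by `rfl`, so the pins are T2's and `Θ_{ρ_∞}(f^H_∞) = 2` is ★ `hasArchOpTrace_two`.  READER: typ3's payer of
`sock_S10_realiseH₂ : RealiseH₂Letter R90.S2.CuspG₀ R90.S2.CuspH₀` (rows R8.3–R8.10 + R8.5∕R8.6 of PAYER-TABLE-realiseH2.v1).  [cite: Rogawski1990, §13.8 Prop. 13.8.3 (proof) p. 218 L15–28;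
§12.3 Prop. 12.3.2 p. 178] [cite: ClozelDelorme1984] [cite: Shelstad1979, L. 5.3] -/
theorem archSignKitCusp_of_archBlockPacketCusp
    (hT2 :
      ∀ (L : Type) [Field L] [NumberField L] [IsCMField L] (μ : HeckeCharacter L)
        [MeasurableSpace (GInf L)] [BorelSpace (GInf L)] (ν : Measure (GInf L)) [ν.IsHaarMeasure] [ν.IsMulRightInvariant]
        [MeasurableSpace (HInf L)] [BorelSpace (HInf L)] (νH : Measure (HInf L)) [νH.IsHaarMeasure] [νH.IsMulRightInvariant],
      letI : ∀ a : HInf L, MeasurableSpace (HInf L ⧸ Subgroup.centralizer ({a} : Set (HInf L))) := fun _ => borel _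
      haveI : ∀ a : HInf L, BorelSpace (HInf L ⧸ Subgroup.centralizer ({a} : Set (HInf L))) := fun _ => ⟨rfl⟩
      letI : ∀ γ : GInf L, MeasurableSpace (GInf L ⧸ Subgroup.centralizer ({γ} : Set (GInf L))) := fun _ => borel _
      haveI : ∀ γ : GInf L, BorelSpace (GInf L ⧸ Subgroup.centralizer ({γ} : Set (GInf L))) := fun _ => ⟨rfl⟩
      ∀ (mH : OrbitalMeasureFamily (HInf L)) (mG : OrbitalMeasureFamily (GInf L))
        (tH : ∀ a : HInf L, Measure (Subgroup.centralizer ({a} : Set (HInf L))))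
        (t : ∀ γ : GInf L, Measure (Subgroup.centralizer ({γ} : Set (GInf L)))),
        mG.IsQuotientOf (fun γ => IsRegularElt (γ.val : GL (Fin 3) (mixedEmbedding.mixedSpace L))) ν t →
        (∀ (γ₁ γ₂ : GInf L)
            (h₁ : IsRegularElt (γ₁.val : GL (Fin 3) (mixedEmbedding.mixedSpace L)))
            (hc : Corresponds (UnitaryGroup.conjMixed (↥(maximalRealSubfield L)) L (IsCMField.complexConj L))
              (UnitaryGroup.archFormOf L 3 (phi3 L)) (UnitaryGroup.archFormOf L 3 (phi3 L)) γ₁ γ₂),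
            Measure.map ⇑(UnitaryGroup.archStableCentralizerEquiv L (UnitaryGroup.isUnit_antidiagOne_det L 3).ne_zero
              (UnitaryGroup.isUnit_antidiagOne_det L 3).ne_zero hc h₁) (t γ₁) = t γ₂) →
        ArchCompatibleFamiliesH L νH mH tH t →
        IsArchNondegenerate L (phi3 L) (archDeltaPP L μ) →
        IsArchDeltaTransferExists L (phi3 L) (archDeltaPP L μ) mH mG (ArchSmooth L 3 (phi3 L)) (ArchSmooth₂ L) →
          ∃ (κ : Type) (_ : Fintype κ) (_ : DecidableEq κ)
            (EG : κ → Type) (_ : ∀ k, NormedAddCommGroup (EG k)) (_ : ∀ k, InnerProductSpace ℂ (EG k)) (_ : ∀ k, CompleteSpace (EG k))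
            (ϖ : ∀ k, ContRepresentation ℂ (GInf L) (EG k)) (hu : ∀ k, (ϖ k).IsUnitary) (hsc : ∀ k, (ϖ k).IsStronglyContinuous)
            (_ : ∀ k, (ϖ k).IsTopIrreducible)
            (f : κ → C_c(GInf L, ℂ)) (_ : ∀ k, ArchSmooth L 3 (phi3 L) ⇑(f k))
            (_ : ∀ k k', HasArchOpTrace ν (ϖ k) (hu k) (hsc k) (f k') (if k = k' then 1 else 0))
            (_ : ∀ (E : Type) [NormedAddCommGroup E] [InnerProductSpace ℂ E] [CompleteSpace E]
                (π : ContRepresentation ℂ (GInf L) E) (hπu : π.IsUnitary) (hπsc : π.IsStronglyContinuous), π.IsTopIrreducible →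
                (∀ k, ¬ ContRepresentation.AreUnitarilyEquivalent (ϖ k) π) → ∀ k, HasArchOpTrace ν π hπu hπsc (f k) 0)
            (s : κ → ℤ) (_ : ∀ k, s k = 1 ∨ s k = -1) (_ : ∃ k k', s k ≠ s k')
            (EH : Type) (_ : NormedAddCommGroup EH) (_ : InnerProductSpace ℂ EH) (_ : CompleteSpace EH)
            (ρ : ContRepresentation ℂ (HInf L) EH) (huH : ρ.IsUnitary) (hscH : ρ.IsStronglyContinuous),
            IsArchEndoCharId L (archDeltaPP L μ) mH mG ν νH EG ϖ hu hsc s ρ huH hscH ∧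
            ∃ k₁ k₂ : κ, s k₁ = 1 ∧ s k₂ = -1 ∧ (∀ ι : L →+* ℂ, CuspG₀ L mG ι ⇑(f k₁ - f k₂)) ∧ IsArchStablyNull L mG ⇑(f k₁ - f k₂) ∧
              ∃ fH : C_c(HInf L, ℂ), ArchSmooth₂ L ⇑fH ∧ IsArchDeltaTransfer L (phi3 L) (archDeltaPP L μ) mH mG ⇑fH ⇑(f k₁ - f k₂) ∧
                ∀ ι : L →+* ℂ, CuspH₀ L mH ι ⇑fH) :
    ∀ (L : Type) [Field L] [NumberField L] [IsCMField L] (μ : HeckeCharacter L)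
      [MeasurableSpace (GInf L)] [BorelSpace (GInf L)] (ν : Measure (GInf L)) [ν.IsHaarMeasure] [ν.IsMulRightInvariant]
      [MeasurableSpace (HInf L)] [BorelSpace (HInf L)] (νH : Measure (HInf L)) [νH.IsHaarMeasure] [νH.IsMulRightInvariant],
    letI : ∀ a : HInf L, MeasurableSpace (HInf L ⧸ Subgroup.centralizer ({a} : Set (HInf L))) := fun _ => borel _
    haveI : ∀ a : HInf L, BorelSpace (HInf L ⧸ Subgroup.centralizer ({a} : Set (HInf L))) := fun _ => ⟨rfl⟩
    letI : ∀ γ : GInf L, MeasurableSpace (GInf L ⧸ Subgroup.centralizer ({γ} : Set (GInf L))) := fun _ => borel _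
    haveI : ∀ γ : GInf L, BorelSpace (GInf L ⧸ Subgroup.centralizer ({γ} : Set (GInf L))) := fun _ => ⟨rfl⟩
    ∀ (mH : OrbitalMeasureFamily (HInf L)) (mG : OrbitalMeasureFamily (GInf L))
      (tH : ∀ a : HInf L, Measure (Subgroup.centralizer ({a} : Set (HInf L))))
      (t : ∀ γ : GInf L, Measure (Subgroup.centralizer ({γ} : Set (GInf L)))),
      mG.IsQuotientOf (fun γ => IsRegularElt (γ.val : GL (Fin 3) (mixedEmbedding.mixedSpace L))) ν t →
      (∀ (γ₁ γ₂ : GInf L)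
          (h₁ : IsRegularElt (γ₁.val : GL (Fin 3) (mixedEmbedding.mixedSpace L)))
          (hc : Corresponds (UnitaryGroup.conjMixed (↥(maximalRealSubfield L)) L (IsCMField.complexConj L))
            (UnitaryGroup.archFormOf L 3 (phi3 L)) (UnitaryGroup.archFormOf L 3 (phi3 L)) γ₁ γ₂),
          Measure.map ⇑(UnitaryGroup.archStableCentralizerEquiv L (UnitaryGroup.isUnit_antidiagOne_det L 3).ne_zero
            (UnitaryGroup.isUnit_antidiagOne_det L 3).ne_zero hc h₁) (t γ₁) = t γ₂) →
      ArchCompatibleFamiliesH L νH mH tH t →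
      IsArchNondegenerate L (phi3 L) (archDeltaPP L μ) →
      IsArchDeltaTransferExists L (phi3 L) (archDeltaPP L μ) mH mG (ArchSmooth L 3 (phi3 L)) (ArchSmooth₂ L) →
        ∃ 𝔞 : ArchSignKit L (archDeltaPP L μ) mH mG ν νH,
          (∀ ι : L →+* ℂ, CuspG₀ L mG ι ⇑𝔞.frozenG) ∧ IsArchStablyNull L mG ⇑𝔞.frozenG ∧
            ∃ fH : C_c(HInf L, ℂ), ArchSmooth₂ L ⇑fH ∧ IsArchDeltaTransfer L (phi3 L) (archDeltaPP L μ) mH mG ⇑fH ⇑𝔞.frozenG ∧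
              (∀ ι : L →+* ℂ, CuspH₀ L mH ι ⇑fH) ∧
                (letI := 𝔞.instNACGH; letI := 𝔞.instIPSH; letI := 𝔞.instCSH; HasArchOpTrace νH 𝔞.ρH 𝔞.huH 𝔞.hscH fH 2) := by
  intro L _ _ _ μ _ _ ν _ _ _ _ νH _ _ mH mG tH t hW hC hWH hnd h5
  obtain ⟨κ, _, _, EG, _, _, _, ϖ, hu, hsc, hirr, f, hsm, hδ, hvan, s, -, -, EH, _, _, _, ρ, huH, hscH, hci,
      k₁, k₂, hs₁, hs₂, hcuspG, hnull, fH, hsmH, htr, hcuspH⟩ := hT2 L μ ν νH mH mG tH t hW hC hWH hnd h5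
  have hk : k₁ ≠ k₂ := fun h => by
    rw [h, hs₂] at hs₁
    omega
  have hfr : ArchSmooth L 3 (phi3 L) ⇑(f k₁ - f k₂) := by
    rw [CompactlySupportedContinuousMap.coe_sub]
    exact archSmooth_sub L (hsm k₁) (hsm k₂)
  obtain ⟨𝔞, h𝔞⟩ : ∃ 𝔞 : ArchSignKit L (archDeltaPP L μ) mH mG ν νH, 𝔞.frozenG = f k₁ - f k₂ :=
    ⟨{ κ := κ, EG := EG, ϖ := ϖ, hu := hu, hsc := hsc, hirr := hirr, f := f,
       hpc := isArchPseudoCoeffSystem_of_pseudoCoeff hδ hvan,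
       s := s, k₁ := k₁, k₂ := k₂, hk := hk, hs₁ := hs₁, hs₂ := hs₂, hsmFrozen := hfr,
       EH := EH, ρH := ρ, huH := huH, hscH := hscH, hci := hci }, rfl⟩
  have htr' : IsArchDeltaTransfer L (phi3 L) (archDeltaPP L μ) mH mG ⇑fH ⇑𝔞.frozenG := by
    rw [h𝔞]
    exact htr
  refine ⟨𝔞, fun ι => ?_, ?_, fH, hsmH, htr', hcuspH, 𝔞.hasArchOpTrace_two fH hsmH htr'⟩
  · rw [h𝔞]
    exact hcuspG ι
  · rw [h𝔞]
    exact hnull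

end Summit.HodgeConjecture.HodgeConjecture.R90.S10

end
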